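import Summits.QuantumFields.YangMills.Theorems.FluctuationComparisonRegPrIntLS2BetaRelativeTowerSupBudget128
import HarnessLib

/-!
# S2β · THE SUP CHAIN ∕ (D-stage): THE SUP BUDGET OF A STAGE TOWER IN THE EXPLICIT SMALL-BOND GUARD `arc(V e) ≤ 1∕128` — θ-GENERIC EDITION:
# for ANY threshold profile `θ′` inside the explicit windows `θ′(i) ≤ a₀(L)`, `Σ_{i<K−J} θ′(K−i) ≤ S₀(L)`: arcs `≤ 1∕4` at every gauged level, `Σ_t s_{t+1} ≤ E(L)`, `Σ_t s_{t+1}² ≤ E(L)`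

Cell `ym3-torus` (YM ladder rung R3 = continuum `SU(2)` Yang–Mills on the three-torus at fixed lattice data — a RUNG: NOT d = 4, NOT infinite volume, NOT a mass gap,
NOT Clay).  Width seat «width 12» `ym3-torus-px12` (gen 26), FREE px helper on crux `stmt-QuantumFields-20520`; `--kind proof --supports stmt-QuantumFields-20520 --as
helper`, count-neutral, DEFINITION-FREE (0 `def`, 0 `instance`, 0 `notation`, 0 `sorry`; ONE decl-local `set_option maxHeartbeats 400000 in`, as in ✓`exists_gamma_supBudget_128`).

WHY (architect 20:11:52Z on ✓p833422: «the LIFT-LADDER letter's constant prefix is `∀ L > 1, ∀ C_B ≥ 0, ∃ α₀ ∃ A ∃ β ∃ C ∃ c, ∀ F … θ … α …` — NO `b₀, p₀, γ`»).  This lineage's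
✓`…RelativeTowerSupBudget128.exists_gamma_supBudget_128` (px12 g24) — the root of ✓p832020 (ARC-PROFILE), ✓p832427 (COMB-ROW′ from the guard) and ✓p833422 ((RSP-Σ)) — is
stated at `θ := θBal L γ b₀ p₀` with a window `γ ≤ γ₁(L,b₀,p₀)`.  Its proof uses `θBal` ONLY through ✓`thresholdSum_small`'s two outputs: every level `θBal(i) ≤ a₀(L)`
and `(A₁+A₂)·Σ_{i<K−J} θBal(K−i) ≤ Smax(L)∕2`.  THIS FILE re-runs the same proof with those two facts as HYPOTHESES on an arbitrary profile `θ′` (the letter's `α ≤ α₀`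
window in sup∕sum form), so that the three consumers get θ-generic editions by one-line re-composition; the `θBal` theorem is the special case (✓`thresholdSum_small`).

WHAT IS PROVED (sorry-free).  ★★★`exists_supBudget_128_theta (L) (hL : 1 < L) : ∃ E ≥ 0, ∃ a₀ > 0, ∃ S₀ > 0, ∀ F θ′, F.L = L → (∀ i, 0 ≤ θ′ i) → (∀ i, θ′ i ≤ a₀) →
∀ J K hJK, Σ_{i<K−J} θ′(K−i) ≤ S₀ → ∀ Vd (guard 1∕128) U ∈ fibre(Vd) ∩ histGood(θ′), ∀ g w V ⟨hat weights, lift formula, (T1), (T4), (T5)⟩,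
∃ s ≥ 0, (arcs ≤ s t, t ≤ K−J) ∧ (s t ≤ 1∕4) ∧ Σ_{t<K−J} s(t+1) ≤ E ∧ Σ_{t<K−J} s(t+1)² ≤ E` — the statement of ✓`exists_gamma_supBudget_128` with
`(γ, b₀, p₀, θBal, γ₁)` replaced by `(θ′, a₀, S₀)`; proof = its proof verbatim (constants `NP, G, A₁, A₂, C₂, r₀, M, Smax, q, E, a₀` identical; `S₀ := Smax∕(2(A₁+A₂+1))`).

HONEST SCOPE.  A re-quantification of a landed proof; nothing of Bałaban's renormalisation-group analysis is asserted or proved ([Balaban1985RegularSpaces] Lemma 1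
(1.24)–(1.26) p.79, (1.29) p.81 — the printed small-field regularity); the θ-generic re-compositions of ✓p832020∕✓p832427∕✓p833422, the letters' windows, LIFT-LADDER,
(ST″), LOC, D-GUARD, GAP♯∘ (`stub_uniformFibreGapOrbit`, registry 3732b7df UNTOUCHED), the five registered stubs (0∕5), S2β, 20520, 19936, 19200, `YM3TorusSU2` are NOT
proved; no registered stub is closed; rung R3 — NOT d = 4, NOT infinite volume, NOT a mass gap, NOT Clay; the Yang–Mills mass gap is NOT proved.
-/

set_option autoImplicit false

noncomputable section

namespace Summit.QuantumFields.YangMills.Theorems.FluctuationComparisonRegPrIntLS2BetaRelativeTowerSupBudgetTheta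

open Finset
open scoped Real
open Literature.MathematicalPhysics.QuantumLattice (su2Quat)
open Literature.MathematicalPhysics.QuantumFieldTheory.Balaban1983to89
open T4Continuum T3ContinuumYM3Torus T3UnitScaleTilt T3TiltDescent T3LevelShift BlockAveraging
open T4CubeChartGnomonic (SU2)
open T4HaarSU2ExpChart (expPoint)
open T4ExpWindowSmallField (logVec)
open T3UnitLawDensityEML (ℰp)
open T3ConstrainedMinimiser (fibre)
open B10Eq27TorusAxialLog (rel axialT)
open Summit.QuantumFields.YangMills.Theorems.FluctuationComparisonRegPrIntLS2BetaRelativeTowerSupProfileStart (exists_supProfile_relativeTower_start)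
open Summit.QuantumFields.YangMills.Theorems.FluctuationComparisonRegPrIntLS2BetaContractingSupStart
  (sq_budget_of_start linearised_of_bootstrap_start sum_succ_le_of_contract_start)
open Summit.QuantumFields.YangMills.Theorems.FluctuationComparisonRegPrIntLS2BetaRelativeTowerSupBudgetStart (norm_logVec_iter_le_of_mem_fibre)

open Summit.QuantumFields.YangMills.Theorems.FluctuationComparisonRegPrIntLS2BetaRelativeTowerSupBudget128 (one_div_128_le_ceiling)

set_option maxHeartbeats 400000 in
/-- ★★★ **THE SUP BUDGET IN THE EXPLICIT GUARD `1∕128`, θ-GENERIC EDITION**: there are constants `E(L) ≥ 0`, `a₀(L) > 0`, `S₀(L) > 0` such that for ANY threshold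
profile `θ′ ≥ 0` with every level `≤ a₀` and level sum `Σ_{i<K−J} θ′(K−i) ≤ S₀`, a datum with `arc(V e) ≤ 1∕128` at every bond, a good history `U ∈ fibre(V) ∩ histGood(θ′)`
and its stage tower (hat lift, (T1), (T4), (T5)), there is a sup profile `s ≥ 0` of the gauged levels with every level `≤ 1∕4`, `Σ_{t<K−J} s(t+1) ≤ E` and
`Σ_{t<K−J} s(t+1)² ≤ E` — depth- and volume-free, NO `γ, b₀, p₀`. [cite: Balaban1985RegularSpaces, Lemma 1 p.79, (1.29) p.81] -/
theorem exists_supBudget_128_theta (L : ℕ) (hL : 1 < L) :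
    ∃ E : ℝ, 0 ≤ E ∧ ∃ a₀ : ℝ, 0 < a₀ ∧ ∃ S₀ : ℝ, 0 < S₀ ∧ ∀ (F : T3Family) (θ' : ℕ → ℝ), F.L = L → (∀ i, 0 ≤ θ' i) → (∀ i, θ' i ≤ a₀) →
      ∀ (J K : ℕ) (hJK : J ≤ K), ∑ i ∈ range (K - J), θ' (K - i) ≤ S₀ →
      ∀ (Vd : GaugeField (F.P J) 0 SU2), (∀ e, ‖logVec (su2Quat (Vd e))‖ ≤ 1 / 128) →
      ∀ (U : GaugeField (F.P K) 0 SU2), U ∈ fibre F ℰp J K hJK Vd → U ∈ histGood F ℰp θ' K J →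
      ∀ (g : (j : ℕ) → Site (F.P K) j → SU2) (w : (t : ℕ) → PBond (F.P K) t → PBond (F.P K) (t + 1) → ℝ)
        (V : (t : ℕ) → GaugeField (F.P K) t SU2),
        (∀ t, t < K - J → ∀ b e, w t b e = if e.dir = b.dir ∧ (b.src b.dir - emb e.src b.dir).val < (F.P K).L then
          ∏ ν ∈ Finset.univ.erase b.dir, max 0 (1 - ((rel (emb e.src) b.src ν).natAbs : ℝ) / (F.P K).L) else 0) →
        (∀ t, t < K - J → ∀ b, V t b = expPoint (∑ e, w t b e • ((((F.P K).L : ℕ) : ℝ)⁻¹ •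
          logVec (su2Quat (GaugeField.gaugeAct (g (t + 1)) (Averaging.iter (fun k => blockAvg (P := F.P K) (j := k) ℰp) (t + 1) U) e))))) →
        (∀ j, K - J ≤ j → ∀ y, g j y = 1) →
        (∀ t, t < K - J → ∀ z : Site (F.P K) t,
          axialT (GaugeField.gaugeAct (g t) (Averaging.iter (fun k => blockAvg (P := F.P K) (j := k) ℰp) t U)) (emb (blockOf z)) z =
            axialT (V t) (emb (blockOf z)) z) →
        (∀ t, t < K - J → avgFun ℰp (GaugeField.gaugeAct (g t) (Averaging.iter (fun k => blockAvg (P := F.P K) (j := k) ℰp) t U)) =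
          GaugeField.gaugeAct (g (t + 1)) (Averaging.iter (fun k => blockAvg (P := F.P K) (j := k) ℰp) (t + 1) U)) →
        ∃ s : ℕ → ℝ, (∀ t, 0 ≤ s t) ∧
          (∀ t, t ≤ K - J → ∀ b, ‖logVec (su2Quat (GaugeField.gaugeAct (g t) (Averaging.iter (fun k => blockAvg (P := F.P K) (j := k) ℰp) t U) b))‖ ≤ s t) ∧
          (∀ t, t ≤ K - J → s t ≤ 1 / 4) ∧ ∑ t ∈ range (K - J), s (t + 1) ≤ E ∧ ∑ t ∈ range (K - J), s (t + 1) ^ 2 ≤ E := by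
  -- the constants of the one-level step at `d = 3`, block size `L` (px17's)
  have hL' : (1 : ℝ) < L := by exact_mod_cast hL
  have hL0 : (0 : ℝ) < L := by linarith
  obtain ⟨NP, hNP⟩ : ∃ x : ℝ, x = (((3 - 1) * ((L - 1) / 2) * (L + 1) : ℕ) : ℝ) := ⟨_, rfl⟩
  obtain ⟨G, hG⟩ : ∃ x : ℝ, x = ((((3 + 2) * L : ℕ) : ℝ) ^ 2 / 4) := ⟨_, rfl⟩
  have hNP0 : 0 ≤ NP := by rw [hNP]; positivity
  have hG0 : 0 < G := by rw [hG]; positivity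
  obtain ⟨A₁, hA₁⟩ : ∃ x : ℝ, x = π / 2 * (NP + 2 * G) := ⟨_, rfl⟩
  obtain ⟨A₂, hA₂⟩ : ∃ x : ℝ, x = π / 2 * (NP * ((L : ℝ)⁻¹) ^ 2 * (π / 2)) := ⟨_, rfl⟩
  obtain ⟨C₂, hC₂⟩ : ∃ x : ℝ, x = π / 2 * NP * 24 * ((L : ℝ)⁻¹) ^ 2 := ⟨_, rfl⟩
  obtain ⟨r₀, hr₀⟩ : ∃ x : ℝ, x = (L : ℝ)⁻¹ := ⟨_, rfl⟩
  have hA₁0 : 0 ≤ A₁ := by rw [hA₁]; positivity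
  have hA₂0 : 0 ≤ A₂ := by rw [hA₂]; positivity
  have hC₂0 : 0 ≤ C₂ := by rw [hC₂]; positivity
  have hr00 : 0 ≤ r₀ := by rw [hr₀]; positivity
  have hr01 : r₀ < 1 := by rw [hr₀]; exact inv_lt_one_of_one_lt₀ hL'
  have h1r : 0 < 1 - r₀ := by linarith
  -- the ceiling `M` and the threshold budget `Smax`
  obtain ⟨M, hM⟩ : ∃ x : ℝ, x = min (1 / 4) ((1 - r₀) / (2 * (C₂ + 1))) := ⟨_, rfl⟩
  have hM0 : 0 < M := by rw [hM]; exact lt_min (by norm_num) (by positivity)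
  have hM4 : M ≤ 1 / 4 := by rw [hM]; exact min_le_left _ _
  have hMC : C₂ * M ≤ (1 - r₀) / 2 := by
    have h1 : M ≤ (1 - r₀) / (2 * (C₂ + 1)) := by rw [hM]; exact min_le_right _ _
    calc C₂ * M ≤ (C₂ + 1) * ((1 - r₀) / (2 * (C₂ + 1))) := by nlinarith
      _ = (1 - r₀) / 2 := by field_simp
  obtain ⟨Smax, hSmax⟩ : ∃ x : ℝ, x = (1 - r₀) / 2 * M := ⟨_, rfl⟩
  have hSmax0 : 0 < Smax := by rw [hSmax]; positivity
  -- the linearised ratio and the budget `E`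
  obtain ⟨q, hq⟩ : ∃ x : ℝ, x = r₀ + C₂ * M := ⟨_, rfl⟩
  have hq0 : 0 ≤ q := by rw [hq]; positivity
  have hq1 : q < 1 := by rw [hq]; linarith
  obtain ⟨E, hE⟩ : ∃ x : ℝ, x = M * ((q * M + Smax) / (1 - q) + M) / 3 := ⟨_, rfl⟩
  have hE0 : 0 ≤ E := by
    rw [hE]
    have : 0 ≤ (q * M + Smax) / (1 - q) := div_nonneg (by positivity) (by linarith)
    positivity
  -- the size guard for a single threshold: the `ℰp` guards (px17's `a₀`)
  have hδSU := ExpMeanLog.deltaSU_pos (n := Fin 2)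
  obtain ⟨a₀, ha₀⟩ : ∃ x : ℝ, x = min (min (ExpMeanLog.deltaSU (Fin 2) / (2 * G)) (1 / (6 * G))) (Smax / (2 * (A₂ + 1))) := ⟨_, rfl⟩
  have ha₀0 : 0 < a₀ := by rw [ha₀]; exact lt_min (lt_min (by positivity) (by positivity)) (by positivity)
  obtain ⟨S₀, hS₀⟩ : ∃ x : ℝ, x = Smax / (2 * (A₁ + A₂ + 1)) := ⟨_, rfl⟩
  have hS₀0 : 0 < S₀ := by rw [hS₀]; positivity
  -- the explicit guard: `1∕128 ≤ M(L)` for every `L ≥ 2` (`NP ≤ L² − 1`, `π < 3.15`)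
  have h128 : (1 : ℝ) / 128 ≤ M := by rw [hM, hC₂, hr₀, hNP]; exact one_div_128_le_ceiling L hL
  have hEM0 : 0 ≤ 3 * E / M := by positivity
  refine ⟨3 * E / M, hEM0, a₀, ha₀0, S₀, hS₀0, fun F θ' hFL hθ0' hθa0 J K hJK hθS Vd hVσ' U hUf hUg g w V hw hV hT1 hax hT5 => ?_⟩
  have hVσ : ∀ e, ‖logVec (su2Quat (Vd e))‖ ≤ M := fun e => (hVσ' e).trans h128
  have hPd : (F.P K).d = 3 := rfl
  have hPL : (F.P K).L = L := hFL
  have hm : K - J ≤ (F.P K).m + (F.P K).K := by show K - J ≤ F.m + K; omega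
  -- thresholds on the gauged levels (gauge invariance of plaquette sizes)
  set θ : ℕ → ℝ := fun t => θ' (K - t) with hθ
  have hθ0 : ∀ t, 0 ≤ θ t := fun t => hθ0' _
  have hθa' : ∀ t, θ t ≤ a₀ := fun t => hθa0 _
  have hθU : ∀ t, t ≤ K - J → PlaqSmall (θ t) (GaugeField.gaugeAct (g t) (Averaging.iter (fun k => blockAvg (P := F.P K) (j := k) ℰp) t U)) := by
    intro t ht p
    rw [T4ReTrLipUnitary.plaqHol_gaugeAct, GaugeGroup.dist1_conj]
    exact hUg t (by omega) p
  -- the guards from `θ ≤ a₀`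
  have hGa : G * a₀ < ExpMeanLog.deltaSU (Fin 2) ∧ G * a₀ ≤ 1 / 6 := by
    have h1 : a₀ ≤ ExpMeanLog.deltaSU (Fin 2) / (2 * G) := by rw [ha₀]; exact (min_le_left _ _).trans (min_le_left _ _)
    have h2 : a₀ ≤ 1 / (6 * G) := by rw [ha₀]; exact (min_le_left _ _).trans (min_le_right _ _)
    constructor
    · calc G * a₀ ≤ G * (ExpMeanLog.deltaSU (Fin 2) / (2 * G)) := mul_le_mul_of_nonneg_left h1 hG0.le
        _ = ExpMeanLog.deltaSU (Fin 2) / 2 := by field_simp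
        _ < ExpMeanLog.deltaSU (Fin 2) := by linarith
    · calc G * a₀ ≤ G * (1 / (6 * G)) := mul_le_mul_of_nonneg_left h2 hG0.le
        _ = 1 / 6 := by field_simp
  have hg1 : ∀ t, t < K - J → (((((F.P K).d + 2) * (F.P K).L : ℕ) : ℝ) ^ 2 / 4) * θ t < ExpMeanLog.deltaSU (Fin 2) := by
    intro t _; rw [hPd, hPL, ← hG]
    exact lt_of_le_of_lt (mul_le_mul_of_nonneg_left (hθa' t) hG0.le) hGa.1
  have hg2 : ∀ t, t < K - J → (((((F.P K).d + 2) * (F.P K).L : ℕ) : ℝ) ^ 2 / 4) * θ t ≤ 1 / 6 := by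
    intro t _; rw [hPd, hPL, ← hG]
    exact le_trans (mul_le_mul_of_nonneg_left (hθa' t) hG0.le) hGa.2
  -- the general-top profile and its conditional quadratic step
  obtain ⟨s, hsm, hs0, hsb, hstep⟩ := exists_supProfile_relativeTower_start hm
    (fun t => GaugeField.gaugeAct (g t) (Averaging.iter (fun k => blockAvg (P := F.P K) (j := k) ℰp) t U)) w V hw hV hax hT5 θ hθ0 hθU hg1 hg2
  -- the START: the top of the tower is the datum (trivial top gauge), bond by bond
  have hstart : s (K - J) ≤ M := by
    refine hsm M fun b => ?_
    have hg0 : g (K - J) = fun _ => 1 := funext (hT1 (K - J) le_rfl)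
    simp only [hg0, T4AxialGaugeFixing.gaugeAct_const_one]
    exact norm_logVec_iter_le_of_mem_fibre F hJK hUf hVσ b
  -- the step in the bootstrap's currency
  set ρ : ℕ → ℝ := fun t => A₁ * θ t + A₂ * θ (t + 1) with hρ
  have hρ0 : ∀ t, 0 ≤ ρ t := fun t => add_nonneg (mul_nonneg hA₁0 (hθ0 t)) (mul_nonneg hA₂0 (hθ0 _))
  have hstep' : ∀ t, t < K - J → s (t + 1) ≤ 1 / 4 → s t ≤ r₀ * s (t + 1) + ρ t + C₂ * s (t + 1) ^ 2 := by
    intro t ht h4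
    have h := hstep t ht h4
    rw [hPd, hPL] at h
    refine h.trans (le_of_eq ?_)
    simp only [hρ, hA₁, hA₂, hC₂, hr₀, hNP, hG]
    ring
  -- the threshold sum: `Σ_{t<m} ρ t ≤ (A₁ + A₂)·Σθ + A₂·a₀ ≤ Smax` (px17's count verbatim)
  have hSρ : ∑ t ∈ range (K - J), ρ t ≤ Smax := by
    have hs1 : ∑ t ∈ range (K - J), ρ t =
        A₁ * ∑ t ∈ range (K - J), θ t + A₂ * ∑ t ∈ range (K - J), θ (t + 1) := by
      simp only [hρ, sum_add_distrib, mul_sum]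
    have hshift : ∑ t ∈ range (K - J), θ (t + 1) ≤ ∑ t ∈ range (K - J), θ t + a₀ := by
      rcases Nat.eq_zero_or_pos (K - J) with h0 | hpos
      · rw [h0]; simp [ha₀0.le]
      · obtain ⟨m, hm'⟩ : ∃ m, K - J = m + 1 := ⟨K - J - 1, by omega⟩
        rw [hm', Finset.sum_range_succ' θ, Finset.sum_range_succ (fun t => θ (t + 1))]
        have := hθ0 0
        have := hθa' (m + 1)
        linarith
    have hmain : (A₁ + A₂) * ∑ i ∈ range (K - J), θ' (K - i) ≤ Smax / 2 := by
      have hA0 : 0 ≤ A₁ + A₂ := by positivity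
      calc (A₁ + A₂) * ∑ i ∈ range (K - J), θ' (K - i) ≤ (A₁ + A₂) * S₀ := mul_le_mul_of_nonneg_left hθS hA0
        _ ≤ (A₁ + A₂ + 1) * S₀ := mul_le_mul_of_nonneg_right (by linarith) hS₀0.le
        _ = Smax / 2 := by rw [hS₀]; field_simp
    have hθsum0 : 0 ≤ ∑ t ∈ range (K - J), θ t := sum_nonneg fun t _ => hθ0 t
    have ha₀S : A₂ * a₀ ≤ Smax / 2 := by
      have h3 : a₀ ≤ Smax / (2 * (A₂ + 1)) := by rw [ha₀]; exact min_le_right _ _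
      calc A₂ * a₀ ≤ A₂ * (Smax / (2 * (A₂ + 1))) := mul_le_mul_of_nonneg_left h3 hA₂0
        _ ≤ (A₂ + 1) * (Smax / (2 * (A₂ + 1))) := mul_le_mul_of_nonneg_right (by linarith) (by positivity)
        _ = Smax / 2 := by field_simp
    rw [hs1]
    have hA₂sh := mul_le_mul_of_nonneg_left hshift hA₂0
    calc A₁ * ∑ t ∈ range (K - J), θ t + A₂ * ∑ t ∈ range (K - J), θ (t + 1)
        ≤ A₁ * ∑ t ∈ range (K - J), θ t + A₂ * (∑ t ∈ range (K - J), θ t + a₀) := by linarith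
      _ = (A₁ + A₂) * ∑ i ∈ range (K - J), θ' (K - i) + A₂ * a₀ := by simp only [hθ]; ring
      _ ≤ Smax / 2 + Smax / 2 := add_le_add hmain ha₀S
      _ = Smax := by ring
  -- the bootstrap from the start (✓`sq_budget_of_start`)
  have hsmall₁ : Smax ≤ (1 - r₀) / 2 * M := by rw [hSmax]
  obtain ⟨hall, hsq⟩ := sq_budget_of_start s ρ (K - J) r₀ C₂ (1 / 4) M Smax hstart hs0 hρ0 hSρ hstep' hr00 hr01 hC₂0 hM4 hsmall₁ hMC
  obtain ⟨hq0', hq1', hlin⟩ :=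
    linearised_of_bootstrap_start s ρ (K - J) r₀ C₂ (1 / 4) M Smax hstart hs0 hρ0 hSρ hstep' hr00 hr01 hC₂0 hM4 hsmall₁ hMC
  have hl1 := sum_succ_le_of_contract_start _ hq0' hq1' s ρ (K - J) hs0 hlin
  -- `(q·s_top + Σρ)∕(1 − q) + s_top ≤ (q·M + Smax)∕(1 − q) + M = 3E∕M`
  rw [← hq] at hsq hl1
  have h1q : 0 < 1 - q := by linarith
  have hnum : q * s (K - J) + ∑ t ∈ range (K - J), ρ t ≤ q * M + Smax := add_le_add (mul_le_mul_of_nonneg_left hstart hq0) hSρ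
  have hdiv : (q * s (K - J) + ∑ t ∈ range (K - J), ρ t) / (1 - q) ≤ (q * M + Smax) / (1 - q) := div_le_div_of_nonneg_right hnum h1q.le
  have hbound : (q * s (K - J) + ∑ t ∈ range (K - J), ρ t) / (1 - q) + s (K - J) ≤ 3 * E / M := by
    rw [le_div_iff₀ hM0, hE]
    calc ((q * s (K - J) + ∑ t ∈ range (K - J), ρ t) / (1 - q) + s (K - J)) * M
        ≤ ((q * M + Smax) / (1 - q) + M) * M := mul_le_mul_of_nonneg_right (add_le_add hdiv hstart) hM0.le
      _ = 3 * (M * ((q * M + Smax) / (1 - q) + M) / 3) := by ring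
  have hM1 : M ≤ 1 := hM4.trans (by norm_num)
  have h3E : 3 * E ≤ 3 * E / M := by
    rw [le_div_iff₀ hM0]
    nlinarith [hE0]
  refine ⟨s, hs0, hsb, fun t ht => (hall t ht).trans hM4, hl1.trans hbound, (hsq.trans ?_).trans h3E⟩
  calc M * ((q * s (K - J) + ∑ t ∈ range (K - J), ρ t) / (1 - q) + s (K - J))
      ≤ M * (3 * E / M) := mul_le_mul_of_nonneg_left hbound hM0.le
    _ = 3 * E := by field_simp

end Summit.QuantumFields.YangMills.Theorems.FluctuationComparisonRegPrIntLS2BetaRelativeTowerSupBudgetTheta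

end
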